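import Mathlib
import HarnessLib
import HarnessLib.Audit
import Summits.KontsevichZagierPeriods.Statement
import Literature.NumberTheory.Transcendental.KZExpCalculus
import HarnessLib.Audit.Status.Attr

/-!
Route: WeightLine

DORMANT since 2026-08-23T16:56:02Z (reconciler: no traction for 6.1 d (last activity item-proof-filed at 2026-08-17T13:04:30Z); parked, not closed — `ledger route dormant route-KontsevichZagierPeriods-WeightLine --off` to reactivate) — unstaffed, not closed; items shared with open routes are served there. `ledger route dormant <id> --off` reactivates.

# Route WeightLine — the weight line, integrated — exponential derivations of classical identities
are Volterra ladders of KZ-classes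

It suffices to show X = BVR ∧ FVR ∧ ILL ∧ ExpKernel (card weight-line-exponential-ladders, realised
in INTEGRATED form). Truncate
every exponential representation below the level t of its own weight and forget the weight: M_t[σ,
f, g] := [σ ∩ {g < t}, f], a
KZ-class for every rational t. ILL (IntegratedLadderLaw): if a classical combination c becomes an
exponential relation, then
θ(t)·c ∼_KZ Σ_j k_j (slice_t R_j − trunc_(<t) R_j) for finitely many classical total representations
R_j (last coordinate = the
weight level s, supports bounded below) — the exponential detour is a Volterra equation G(t) =
∫_(<t) G for the tame family of
KZ-classes G(t) = Σ k_j slice_t R_j, with the jump c at t = 0. FVR (ForwardVolterraRigidity): such a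
family started hard at s₀
and satisfying G(t) ∼ ∫_(<t) G for rational t < 0 has ∫_(<0) G ∼ 0. BVR (BackwardVolterraRigidity):
G(t) + ∫_(>t) G ∼ c′ for
rational t > 0 forces c′ ∼ 0 and ∫_(>0) G ∼ 0. FVR ∧ BVR ∧ ILL ⇒ KZexp.Conservative (support
WeightLineConservativity, checked on
paper); with ExpKernel — the exponential kernel conjecture of the landed calculus, ker KZexp.eval ≤
KZexp.relations (the content of
KZexp.KernelConjecture, ExpConservative's 0531/0293; stated over the calculus' own
`eval`/`relations` since rev 2 so that the route's
used-constants cone carries no Literature-level open Prop) — the summit follows (deciding theorem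
`closes`).
Lean: `(∀ (J : ℕ) (d : Fin J → ℕ) (k : Fin J → ℤ) (R : (j : Fin J) →
Literature.NumberTheory.Transcendental.KZ.IntegralRep (d j + 1)) (c :
Literature.NumberTheory.Transcendental.KZ.FormalRep), (∀ t : ℚ, 0 < (t : ℝ) → ∀ (S : (j : Fin J) →
Literature.NumberTheory.Transcendental.KZ.IntegralRep (d j)) (T : (j : Fin J) →
Literature.NumberTheory.Transcendental.KZ.IntegralRep (d j + 1)), (∀ j, (S j).domain = {x | Fin.snoc
x (t : ℝ) ∈ (R j).domain} ∧ Set.EqOn (S j).integrand (fun x => (R j).integrand (Fin.snoc x (t : ℝ)))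
(S j).domain ∧ (T j).domain = (R j).domain ∩ {z | (t : ℝ) < z (Fin.last (d j))} ∧ Set.EqOn (T
j).integrand (R j).integrand (T j).domain) → ∑ j, k j •
(Literature.NumberTheory.Transcendental.KZ.of (S j) + Literature.NumberTheory.Transcendental.KZ.of
(T j)) - c ∈ Literature.NumberTheory.Transcendental.KZ.relations) → c ∈
Literature.NumberTheory.Transcendental.KZ.relations ∧ ∀ (T₀ : (j : Fin J) →
Literature.NumberTheory.Transcendental.KZ.IntegralRep (d j + 1)), (∀ j, (T₀ j).domain = (R j).domain
∩ {z | 0 < z (Fin.last (d j))} ∧ Set.EqOn (T₀ j).integrand (R j).integrand (T₀ j).domain) → ∑ j, k j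
• Literature.NumberTheory.Transcendental.KZ.of (T₀ j) ∈
Literature.NumberTheory.Transcendental.KZ.relations) ∧ (∀ (J : ℕ) (d : Fin J → ℕ) (k : Fin J → ℤ) (R
: (j : Fin J) → Literature.NumberTheory.Transcendental.KZ.IntegralRep (d j + 1)) (s₀ : ℝ), (∀ j, ∀ z
∈ (R j).domain, s₀ ≤ z (Fin.last (d j))) → (∀ t : ℚ, (t : ℝ) < 0 → ∀ (S : (j : Fin J) →
Literature.NumberTheory.Transcendental.KZ.IntegralRep (d j)) (T : (j : Fin J) →
Literature.NumberTheory.Transcendental.KZ.IntegralRep (d j + 1)), (∀ j, (S j).domain = {x | Fin.snoc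
x (t : ℝ) ∈ (R j).domain} ∧ Set.EqOn (S j).integrand (fun x => (R j).integrand (Fin.snoc x (t : ℝ)))
(S j).domain ∧ (T j).domain = (R j).domain ∩ {z | z (Fin.last (d j)) < (t : ℝ)} ∧ Set.EqOn (T
j).integrand (R j).integrand (T j).domain) → ∑ j, k j •
(Literature.NumberTheory.Transcendental.KZ.of (S j) - Literature.NumberTheory.Transcendental.KZ.of
(T j)) ∈ Literature.NumberTheory.Transcendental.KZ.relations) → ∀ (T₀ : (j : Fin J) →
Literature.NumberTheory.Transcendental.KZ.IntegralRep (d j + 1)), (∀ j, (T₀ j).domain = (R j).domain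
∩ {z | z (Fin.last (d j)) < 0} ∧ Set.EqOn (T₀ j).integrand (R j).integrand (T₀ j).domain) → ∑ j, k j
• Literature.NumberTheory.Transcendental.KZ.of (T₀ j) ∈
Literature.NumberTheory.Transcendental.KZ.relations) ∧ (∀ c :
Literature.NumberTheory.Transcendental.KZ.FormalRep,
Literature.NumberTheory.Transcendental.KZexp.incl c ∈
Literature.NumberTheory.Transcendental.KZexp.relations → ∃ (J : ℕ) (d : Fin J → ℕ) (k : Fin J → ℤ)
(R : (j : Fin J) → Literature.NumberTheory.Transcendental.KZ.IntegralRep (d j + 1)) (s₀ : ℝ), (∀ j,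
∀ z ∈ (R j).domain, s₀ ≤ z (Fin.last (d j))) ∧ ∀ (t : ℚ) (S : (j : Fin J) →
Literature.NumberTheory.Transcendental.KZ.IntegralRep (d j)) (T : (j : Fin J) →
Literature.NumberTheory.Transcendental.KZ.IntegralRep (d j + 1)), (∀ j, (S j).domain = {x | Fin.snoc
x (t : ℝ) ∈ (R j).domain} ∧ Set.EqOn (S j).integrand (fun x => (R j).integrand (Fin.snoc x (t : ℝ)))
(S j).domain ∧ (T j).domain = (R j).domain ∩ {z | z (Fin.last (d j)) < (t : ℝ)} ∧ Set.EqOn (T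
j).integrand (R j).integrand (T j).domain) → (if (0 : ℚ) < t then c else 0) - ∑ j, k j •
(Literature.NumberTheory.Transcendental.KZ.of (S j) - Literature.NumberTheory.Transcendental.KZ.of
(T j)) ∈ Literature.NumberTheory.Transcendental.KZ.relations) ∧ (AddMonoidHom.ker
Literature.NumberTheory.Transcendental.KZexp.eval ≤
Literature.NumberTheory.Transcendental.KZexp.relations)`

## Assembly
Pure logic (deciding theorem `closes`, rev 2; axioms propext / Classical.choice / Quot.sound):
WeightLineConservativity turns BVR,
FVR, ILL into KZexp.Conservative; given r.value = r'.value the classical combination [r] − [r'] has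
KZexp.eval (incl ([r] − [r'])) = KZ.eval ([r] − [r']) = 0 (`KZexp.eval_incl`, `map_sub`,
`KZ.eval_of`), so ExpKernel makes
incl ([r] − [r']) an exponential relation and conservativity makes [r] − [r'] a KZ relation, i.e.
KZ.Equivalent r r' (the item
`Assembly` is the same implication as a statement: BVR → FVR → ILL → WeightLineConservativity →
ExpKernel → KontsevichZagierPeriods).

Rationale: WHY THIS LINE. Route ExpConservative isolates Conservative (0530: a KZ combination that is an
exponential relation is a KZ relation) as the
H21-specific, below-summit half of the exponential programme but has no decomposition of it; the
tree's retraction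
`KZexp.zeroLocusRetraction` dies on the Newton–Leibniz moves because 1 = ∫₀^∞ e^(−t) dt has no
weight-0 shadow. The card's weight
line (push every representation forward along its own weight; Γ-detours become solutions of G′ = G)
is the real-analytic,
rules-level avatar of the founding construction of exponential Hodge structures / motives
(pushforward to 𝔸¹ and Fourier–Laplace:
arXiv:0811.2435 §4–5, FresanJossen2020 Ch. 2–4, whose Thm 5.1.1 is the motivic shadow of 0530); this
route files it in
integrated (Volterra) form, where the level-t truncation M_t replaces derivatives, so breakpoints,
Reynolds transport and
continuity across atoms disappear and the two rigidity statements have ELEMENTARY values-level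
shadows (ODE uniqueness from a
hard start; v + ∫_t^∞ v = const ⇒ v = Ae^t ∈ L¹ ⇒ A = 0) instead of Gauss–Manin regularity.
Imported: Volterra/renewal
equations (analysis), o-minimal integration theory for the tameness of t ↦ ∫R(x,t)dx
(ComteLionRolin2000, CluckersMiller2011,
used only in why-might-fail and in support WeightBoundedBelow), Lindemann–Weierstrass (tree, proved:
LindemannWeierstrass.SumForm_holds) for sorting primitives Σ hᵢe^(−gᵢ) by exponential type.
Negatives index empty; no prior
route or card states a truncation functor, a Volterra normal form, or a rigidity statement for tame
families of KZ-classes.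

RANKED CRUXES. #2 BackwardVolterraRigidity (crux) — for classical total reps R_j (dims d_j+1, last
coordinate s), integers k_j and a KZ combination c′: if for every rational t > 0 and all KZ
presentations S_j of the slices at level t and T_j of the upper truncations R_j ∩ {s > t} one has Σ
k_j([S_j] + [T_j]) − c′ ∈ KZ.relations, then c′ ∈ KZ.relations and Σ k_j[R_j ∩ {s > 0}] ∈
KZ.relations (card N2 'NSE', right half-line incl. the +∞ end, integrated). [difficulty:
open-problem] (why it might fail: Uniform in t: one KZ-chain per rational level and no move acts
across levels or takes the limit t → +∞ (card limit-is-a-move is open); the values proof needs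
continuity of t ↦ ∫R(x,t)dx off a finite set (Comte–Lion–Rolin), which has no rules-level avatar.)
[KontsevichZagierPeriods2001, ComteLionRolin2000, CluckersMiller2011, FresanJossen2020,
Literature.NumberTheory.Transcendental.KZ.newtonLeibnizRel]
#3 ForwardVolterraRigidity (crux) — for classical total reps R_j supported in {s ≥ s₀}, integers
k_j: if for every rational t < 0 and all KZ presentations S_j (slices at t), T_j (lower truncations
R_j ∩ {s < t}) one has Σ k_j([S_j] − [T_j]) ∈ KZ.relations, then Σ k_j[R_j ∩ {s < 0}] ∈ KZ.relations
(card N2 'NSE', left half-line with hard start, integrated: no semialgebraic Volterra eigenfamily).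
[difficulty: open-problem] (why it might fail: Pointwise relations slice_t ∼ trunc_t at rational t
need not assemble into one relation for trunc_0 (no parameter move; ℤ-saturation 2c ∈ rel ⇒ c ∈ rel
is untested); true at values by ODE uniqueness from the hard start and implied by
KZKernelConjecture, so only unprovability threatens.) [KontsevichZagierPeriods2001,
ComteLionRolin2000, LionRolin1998, Literature.NumberTheory.Transcendental.KZKernelConjecture,
Literature.NumberTheory.Transcendental.KZ.relations_le_ker_eval]
#4 IntegratedLadderLaw (crux) — if incl c ∈ KZexp.relations then there are finitely many classical
total reps R_j (last coordinate = weight level, supports bounded below by some s₀) and k_j ∈ ℤ with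
θ(0<t)·c − Σ k_j([slice_t R_j] − [R_j ∩ {s<t}]) ∈ KZ.relations for every rational t and all KZ
presentations (card N1 'L1' integrated: M_t kills moves 1a, 1b, 2; on a Newton–Leibniz instance
LW-sorting makes the primitive e^(−w)H, roots w = t give slices, H·∂_u w gives truncations, fibre
ends cancel the boundary rep). [deps: WeightBoundedBelow, ExpNotSemialgebraic] [difficulty: XL] (why
it might fail: Ladder reps [branch, H(x,u_j(x,s))] can fail integrability though f = ∂ᵤH − H∂ᵤw ∈ L¹
(H = x⁻³(1+u²), w = u², |u| ≤ x): such parts factored through w and were KZ-null by a glued NL in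
every example, but a general renormalised normal form is unproved; (3b) tails, weight-jump walls.)
[KontsevichZagierPeriods2001, arXiv:0811.2435, FresanJossen2020, BochnakCosteRoy1998,
Literature.NumberTheory.Transcendental.KZexp.newtonLeibnizRel,
Literature.NumberTheory.Transcendental.KZexp.improperNewtonLeibnizRel,
Literature.NumberTheory.Transcendental.KZexp.zeroLocusRetraction,
Literature.NumberTheory.Transcendental.LindemannWeierstrass.SumForm]
#5 ExpKernel (crux) — the exponential kernel conjecture ker(KZexp.eval) ≤ KZexp.relations for the
landed five-move calculus, stated over the calculus' own eval/relations (AddMonoidHom.ker KZexp.eval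
≤ KZexp.relations: every formal ℤ-combination of exponential representations with value 0 is an
exponential relation — the content of KZexp.KernelConjecture = ExpConservative's 0531/0293, wanted
here as ExpKernelConjecture until rev 2 and dropped from THIS route because a Literature-level
[status: open] Prop in the used-constants cone makes the route unstaffable; standing hypothesis of
the kernel half). [difficulty: open-problem] (why it might fail: Rules-form exponential period
conjecture for THIS calculus: stronger than the summit (GPC strength barrier) and may fail for
calculus-size reasons (single-rep boundary terms, no product move) even if every exponential
identity is true.) [Literature.NumberTheory.Transcendental.KZexp.KernelConjecture, FresanJossen2020,
KontsevichZagierPeriods2001, CommelinHabeggerHuber2020,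
Literature.Barriers.KontsevichZagierPeriods.kzConjecture_implies_oddZetaAlgIndep]
#9 WeightLineConservativity (support) — BVR → FVR → ILL → KZexp.Conservative (the glue of the
conservativity half: t < 0 feeds FVR verbatim, giving trunc_(<0) ∼ 0; for rational t > 0 rewrite ILL
with R_j ∩ {s<t} = (R_j ∩ {s<0}) ⊔ (R_j ∩ {0<s<t}) ⊔ null slice and feed BVR with c′ = c + Σ k_j[R_j
∩ {s>0}]; then c′ ∼ 0 ∧ Σ k_j[R_j ∩ {s>0}] ∼ 0 gives c ∼ 0; uses KZ.IntegralRep.restrict and moves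
1a only). [difficulty: provable-now] [Literature.NumberTheory.Transcendental.KZexp.Conservative,
Literature.NumberTheory.Transcendental.KZ.IntegralRep.restrict,
Literature.NumberTheory.Transcendental.KZ.domainAddRel]
#9 WeightBoundedBelow (support) — the weight of a convergent exponential representation is
essentially bounded below on the support of the integrand: ∃ s₀, vol{x ∈ σ : f x ≠ 0, g x < s₀} = 0
(supplies the hard start s₀ of ILL; o-minimal growth: vol{g < −T, f ≠ 0} and |f| decay at most
polynomially while e^(−g) ≥ e^T). [difficulty: L] [ComteLionRolin2000, CluckersMiller2011,
BochnakCosteRoy1998, Literature.NumberTheory.Transcendental.KZexp.IntegralRep]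
#9 ExpNotSemialgebraic (support) — exp is not ℚ-semialgebraic on any open interval (atom of the
LW-sorting of primitives Σ hᵢe^(−gᵢ) by exponential type and of 'no semialgebraic eigenfamily' in
fibre dimension 0; from the tree's Hermite–Lindemann transcendental_exp_holds at one rational point,
or by growth). [difficulty: provable-now]
[Literature.NumberTheory.Transcendental.LindemannWeierstrass.SumForm,
Literature.Barriers.KontsevichZagierPeriods.noSemialgebraicPrimitive_inv_sub_two,
BochnakCosteRoy1998]
#9 BetaGammaTruncated (support) — calibration (card N4b): the truncate-and-forget image of the
Beta–Gamma change of variables (ExpConservative 0533, (u,v) ↦ (uv, u(1−v)), weight x+y = u) is ONE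
KZ change of variables at every rational level t: [{x,y>0, x+y<t}, x^(−2/3)y^(−2/3)] ~
[{0<u<t}×(0,1), u^(−1/3)(v(1−v))^(−2/3)] — weight-preserving moves produce no ladder. [difficulty:
provable-now] [Literature.NumberTheory.Transcendental.KZ.changeOfVariablesRel,
KontsevichZagierPeriods2001, AndrewsAskeyRoy1999]

TWO-LAYER PLAN. Foreseen glued splits (none filed now): IntegratedLadderLaw ⇐ TruncationKillsNLFree
(M_t of every 1a/1b/2 instance is a KZ
relation for every rational t; generalises the proved zeroLocusRetraction) → LadderLawNL (M_t of ONE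
(3a)/(3b) instance =
Σ ±(slice − trunc) of integrable branch reps, with the LW sorting and WeightBoundedBelow) →
IntegratedLadderLaw (additivity of
M_t). BackwardVolterraRigidity ⇐ BoundedEndRigidity (supports bounded above: the mirror image of
FVR) → TailRigidity (the +∞
end: G(t) + ∫_(>t)G ∼ c′ with G, ∫ → ∅ forces c′ ∼ 0) → BVR. ForwardVolterraRigidity ⇐ fibre
dimension d_j ≤ 1 (jointly with
LowDimension 0405/0116, Baker) → general. Kernel side later: ExpKernel ⇐ AtomicIndependence
(rules-level
Lindemann–Weierstrass over P_KZ: the calculus derives no Σ pᵢe^(−αᵢ) ∼ 0) + BoundedVolterraRigidity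
(middle pieces between two
atoms; values shadow = regularity of Gauss–Manin, Deligne1970) + Conjecture 1 for slices — card
(B1)–(B3), not filed.

KILL CRITERIA. An explicit c with incl c ∈ KZexp.relations whose M_t-image admits NO Volterra normal
form with integrable ladder reps refutes
IntegratedLadderLaw: if the witness is the integrability trap only (iterated but not absolute
integrals), restate ILL over
fibrewise-presented truncations (pivot); if M_t-images of Newton–Leibniz instances escape every
slice/truncation shape, close
`refuted:IntegratedLadderLaw`. A refutation of BVR or FVR needs a proof of NON-derivability in the
KZ calculus (an additive
invariant of the four moves finer than eval) — that invariant is worth more than the route: close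
and hand it to Neg; a
values-level 'refutation' would contradict soundness (relations_le_ker_eval_holds) and is
impossible. 0530 proved elsewhere
(retraction/normal form) ⇒ cruxes 2–4 moot for the summit, close `superseded`. 0531 refuted for
calculus-size reasons ⇒ the
assembly dies with ExpConservative's; the conservativity half (cruxes 2–4 ⇒ 0530) survives as this
route's content until a
relations⁺ successor of 0531 is filed by ExpConservative's planner.

NOT DECOMPOSED YET. The kernel half (card B/C: exponential exactness per type = LW over P_KZ,
Conjecture 1 uniformly for slices, bounded-piece
rigidity) — needs M_t on general exponential combinations with several atoms; filed only after ILL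
lands. The truncation functor
M_t as a Lean object (an AddMonoidHom KZexp.FormalRep →+ KZ.FormalRep per rational t, by
`KZ.IntegralRep.restrict` to
{g < t}) — a prover-level definition in the ILL file, not a definition request. The renormalisation
of non-integrable branch reps
(ILL why-might-fail). Improper (3b) tails through M_t (compactifying CoV + KZ rule 3 with
closed-fibre continuity). Reading the
Γ(1) probe 0532 and the triplication chain 0544 through M_t (their ladders) — calibrations for idle
provers via
`--supports IntegratedLadderLaw`. ℚ̄-levels: all statements use rational levels t only (dense; keeps
every truncation
ℚ-semialgebraic); algebraic breakpoints never need to be named in the integrated form.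

CHEAPEST FALSIFIER. ILL by hand on three instances (planner did the first two on paper, see
NOTES.md): (i) n = 0, w = u on [0,1], w ≡ 1 on [1,2],
w = u−1 on [2,3] (plateau) — M_r − M_r′ = Σ(slice − trunc) of R₁ = [(0,1), H], R₂ = [(1,2), H(s+1)]
at every t ✓; (ii) a
weight-jump wall (w = u | u+5): LW forces the class-0 primitive to vanish at the wall and the law
holds ✓; (iii) THE TRAP: band
{0<x<1, |u|≤x}, w = u², F = e^(−u²)(x⁻³(1+u²) + u), r′ = [τ, 2x, x²] (a valid 3a instance): show
M_r(t) − M_r′(t) is (KZ-null odd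
part, by the reflection u ↦ −u and one glued NL) + (slice − trunc of the integrable reps [{0<s<x²},
±√s]) — a refuter who finds a
valid instance whose non-integrable part is NOT null kills ILL as typed. For FVR/BVR the cheapest
rung is d_j = 0 (families of
points on the line): both reduce to 'φ semialgebraic, φ(t) = ∫φ at rational t ⇒ φ = 0 a.e.' plus
null-set bookkeeping —
provable now; then d_j = 1 against LowDimension's Baker items. BetaGammaTruncated (support) is the
cheapest Lean calibration.

NUMBERS. Items at open: 9 (4 cruxes, 4 support, 1 assembly; no target block — X is the conjunction
named in the Thesis); rev 2 (route-repair
2026-08-15): crux ExpKernelConjecture (0293, := KZexp.KernelConjecture) dropped from THIS route (it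
stays wanted by ExpConservative) in favour of the
calculus-level crux ExpKernel, Assembly restated over ExpKernel, deciding theorem `closes` supplied
— again 9 items (4 cruxes, 4 support, 1 assembly);
needs-fact: none (CONE FACTS audit under DEFINITION REQUESTS; unchanged at the gen-3 cone repair
2026-08-15: 0 imports dropped, 0 cruxes restated). Moves of the
landed calculus: 5 (KZExpCalculus.lean D1–D6); M_t kills 3 of them outright (1a, 1b, 2: the proved
zeroLocusRetraction is the
level-0 case), the content sits in (3a), (3b) exactly as `conservative_nlFree` locates it. Known:
Conservative ⟸
KZKernelConjecture ∧ soundness (`conservative_of_kzKernelConjecture`), LW proved in tree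
(SumForm_holds), piecewise smoothness of
semialgebraic functions proved in tree (IsSemialgebraicFunOn.exists_contDiffOn_holds).

DEFINITION REQUESTS. None at open: all nine statements elaborate over KZCalculus/KZExpCalculus
(folder Sketch.lean rc 0). No cite facts wanted: the
o-minimal inputs (ComteLionRolin2000 log-analytic nature of parametric volumes; CluckersMiller2011
stability under integration)
enter only the values-level heuristics and the proof of support WeightBoundedBelow, whose prover may
file them as Literature facts. CONE FACTS (route-repair audit, gen 3, 2026-08-15; census
reconstructed by hand from the import lines and `lean search` for `_holds`, the precomputed view
run/shared/views/cone/KontsevichZagierPeriods.{md,json} being absent on this hub). Decl-level cone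
(gate `#h21_route_deps`, rev 4): 43 project constants, 0 unproved — `ledger route show`: staffable
YES, deciding theorem native-OK. Module-level import cone (priority `module_cone`, the
`require_clean_cone` guardrail): exactly 4 Prop-defs without `_holds`, all four OPEN CONJECTURES
(CONVENTIONS §4 `def … : Prop`, `[status: open]` / `@[conjecture]`), none a published result, none
dischargeable by a literature-prover, none used as a hypothesis by any item or by `closes`: (1)
Literature.NumberTheory.Transcendental.KZexp.KernelConjecture — its content is carried INSIDE the
route as crux ExpKernel (rank 5; route debt, staffed as a crux, not literature debt); (2)
Literature.NumberTheory.Transcendental.KZexp.Conservative — the CONCLUSION of support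
WeightLineConservativity (re-derived from BVR/FVR/ILL, definitionally `… → KZexp.Conservative`),
never assumed; both ride in on the one declared import
Literature.NumberTheory.Transcendental.KZExpCalculus, which is ESSENTIAL: KZexp.incl / relations /
eval / IntegralRep / eval_incl are the vocabulary of ILL, ExpKernel, WeightLineConservativity,
WeightBoundedBelow and of `closes`, and no other module provides them (KZExpCalculusProofs and
KZExpCCalculus both import KZExpCalculus); (3)
Literature.NumberTheory.Transcendental.KZPeriodConjecture′ and (4)
Literature.NumberTheory.Transcendental.KZKernelConjecture (PeriodConjecture.lean: the endpoint form
and the kernel form of the summit itself) ride in on the operator-owned Statement import chain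
(Statement → PeriodConjecture) shared by every route of the summit. So needs-fact: NONE, and the
module-level block is not route-controllable. Remedies outside this route (operator / librarian):
(i) let `module_cone` skip `[status: open]` / `@[conjecture]` decls, or defer to the gate's
decl-level `staffable` verdict (same ask as the QuantumFields, AtomisticToContinuum, Langlands and
WickWedge cone repairs of 2026-08-15); (ii) failing that, split KZExpCalculus.lean into a Prop-free
vocabulary module (everything from `freeAbelianGroup_map_injective` through `Equivalent.of_kz`, plus
`relations_le_comap`, `isSemialgebraic_zeroLocus`, `zeroWeightPart`, `zeroLocusRetraction*`,
`nlFreeRelations*`, `conservative_nlFree`) imported by a conjecture leaf that keeps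
`relations_le_ker_eval`, `KernelConjecture`, `Conservative`, `valuesEqExpPeriods` and the six lemmas
naming them (same namespace, so no downstream rename; KZExpCalculusProofs / Theses/ExpConservative /
Theorems keep importing the leaf) — after which this route's `imports` switch to the vocabulary
module in one `route edit` and facts (1)–(2) leave its module cone ((3)–(4) stay for every route
until (i)).

Novelty: Searches (2026-08-15): `lit frontier KontsevichZagierPeriods --since 2020` (30 rows: Kummer-surface
GPC, odd zeta, MZV coactions, perverse Nori motives arXiv:2401.13547 — none on
exponential-vs-classical derivability); `lit bridges KontsevichZagierPeriods --cross any` (30 rows,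
surveys only); `lit search --hybrid "exponential periods classical periods conservativity Volterra
integral equation tame family Laplace transform"` (12 textbook hits: Graf 2010, Debnath 2014,
Bellman 1984 — Volterra/Laplace generalities); `lit search --hybrid "exponential motives full
faithfulness classical motives perverse sheaves affine line vanishing cycles Fourier"` (10:
Kiehl–Weissauer 2001, Katz 1988/1990, Cisinski–Déglise — ℓ-adic/irregular side, no rules calculus);
`lit galaxy search "exponential periods" | "exponential motives" | "exponential period conjecture"
--star all` (20/1/0 rows: Müller-Stach arXiv:1407.2388 survey, Fischler–Rivoal arXiv:1910.06817 on
E-functions; rest noise); `lit search --source arxiv` rate-limited (429); tree: KZExpCalculus.lean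
(D1–D6, zeroLocusRetraction, conservative_nlFree), route files
ExpConservative/ScissorsTransport/LowDimension, the card and its refuter-8 audit; `ledger negatives`
(0).
Nearest prior art found: arXiv:0811.2435 §4–5 (Kontsevich–Soibelman, exponential Hodge structures:
pushforward along the potential to 𝔸¹ + Fourier–Laplace) and FresanJossen2020 Ch. 2–4, Thm 5.1.1,
Conj 8.2.6 (perverse sheaves on 𝔸¹, classical = supported at a point; full fait  [refs: 2401.13547, 1407.2388, 1910.06817, 0811.2435, 2007.08280, FresanJossen2020, CommelinHabeggerHuber2020]

Barriers (technique_class: weight-line, volterra-rigidity, exp-conservativity): - technique_class: weight-line, volterra-rigidity, exp-conservativity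
- Literature.Barriers.KontsevichZagierPeriods.noSemialgebraicPrimitive_inv_sub_two: evaded — M_t
integrates nothing out and produces no primitive: fibres over the weight level stay KZ
representations, the only primitive used is the Newton–Leibniz instance's own F (input data), and
the one transcendental function of the level, e^t, is excluded by rigidity (FVR/BVR) rather than
computed; the thesis quantifies over all dimensions.
- Literature.Barriers.KontsevichZagierPeriods.kzConjecture_implies_oddZetaAlgIndep: it does not bite
on cruxes 2–4: the conservativity half is BELOW the summit (Conservative ⟸ KZKernelConjecture ∧
soundness, tree `conservative_of_kzKernelConjecture`; FVR/BVR ⟸ KZKernelConjecture + tame analysis;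
ILL is structural and asserts no transcendence); it bites on crux 5 (ExpKernelConjecture,
summit-strength and more) — named there, not evaded; the bet is that the route's deliverable is
0530.
- Literature.Barriers.KontsevichZagierPeriods.kzConjecture_implies_twoPiI_log_algIndep: same as the
previous line (strength barrier carried by crux 5 only).
- Literature.Barriers.KontsevichZagierPeriods.kzConjecture_implies_ellipticPeriods_algIndep: same
(crux 5 only).
- Literature.Barriers.KontsevichZagierPeriods.cressonViuSos_prop_3_2: not applicable — no global
semialgebraic homeomorphism is asked for; all maps are cellwise changes of variables with the
dissection kept (level truncations, branchwise s

History (route lifecycle, newest last):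
- 2026-08-15T16:31:26Z · rev 2: restated Assembly (stmt-KontsevichZagierPeriods-7184) — route-repair (rbadge-…-36e3e9a9-g2), RE-ROUTE AROUND the one unproved cone fact Literature.NumberTheory.Transcendental.KZexp.KernelConjecture ([status: open] co (planner-rbadge-KontsevichZagierPeriods-WeightL-36e3e9a9-g2-0)
- 2026-08-15T16:31:26Z · rev 2: dropped ExpKernelConjecture — route-repair (rbadge-…-36e3e9a9-g2), RE-ROUTE AROUND the one unproved cone fact Literature.NumberTheory.Transcendental.KZexp.KernelConjecture ([status: open] co (planner-rbadge-KontsevichZagierPeriods-WeightL-36e3e9a9-g2-0)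
- 2026-08-15T16:38:07Z · rev 2: restated WeightLineConservativity (stmt-KontsevichZagierPeriods-7180) — route-repair (cone): restate WeightLineConservativity with KZexp.Conservative spelled inline and drop ExpKernelConjecture (:= KZexp.KernelConjecture, item 0293 (planner-rrepair-KontsevichZagierPeriods-Weight-36e3e9a9-0)
- 2026-08-15T16:38:07Z · rev 2: dropped ExpKernelConjecture — route-repair (cone): restate WeightLineConservativity with KZexp.Conservative spelled inline and drop ExpKernelConjecture (:= KZexp.KernelConjecture, item 0293 (planner-rrepair-KontsevichZagierPeriods-Weight-36e3e9a9-0)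
- 2026-08-15T16:39:36Z · rev 3: dropped ExpKernelConjecture, stmt-KontsevichZagierPeriods-10785 — route-repair (rbadge-…-36e3e9a9-g2) COMPLETING rev 2 (the 16:31:26Z edit was recorded only in part during a farm outage: Assembly 7184 retired, thesis/glue text (planner-rbadge-KontsevichZagierPeriods-WeightL-36e3e9a9-g2-0)
- 2026-08-23T16:56:02Z · DORMANT — reconciler: no traction for 6.1 d (last activity item-proof-filed at 2026-08-17T13:04:30Z); parked, not closed — `ledger route dormant route-KontsevichZagierPer (operator:999:3237445)

sub-problem: KontsevichZagierPeriods · status: dormant · opened planner-plancard-KontsevichZagierPeriods-Kont-89d07125-0 2026-08-15T12:04:36Z · rev 6 · ledger route-KontsevichZagierPeriods-WeightLine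
GENERATED by the gate from the ledger (D-0016/17). Provers cite these decls: `theorem foo : Summit.KontsevichZagierPeriods.KontsevichZagierPeriods.Theses.WeightLine.<Decl> := …` in Summits/KontsevichZagierPeriods/KontsevichZagierPeriods/Theorems/<Name>.lean.
-/

namespace Summit.KontsevichZagierPeriods.KontsevichZagierPeriods.Theses.WeightLine

open scoped BigOperators Topology Manifold Classical MeasureTheory ProbabilityTheory Matrix InnerProductSpace ComplexConjugate ContinuousMap
open Filter Set Function TopologicalSpace MeasureTheory

attribute [summit_statement] _root_.KontsevichZagierPeriods

open Literature Periods

/-- item stmt-KontsevichZagierPeriods-7177 · crux · rank 2 · open · by planner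
why it might fail: Uniform in t: one KZ-chain per rational level and no move acts across levels or takes the limit t → +∞ (card limit-is-a-move is open); the values proof needs continuity of t ↦ ∫R(x,t)dx off a finite set (Comte–Lion–Rolin), which has no rules-level avatar.
sources: KontsevichZagierPeriods2001, ComteLionRolin2000, CluckersMiller2011, FresanJossen2020, Literature.NumberTheory.Transcendental.KZ.newtonLeibnizRel
[crux] for classical total reps R_j (dims d_j+1, last coordinate s), integers k_j and a KZ
combination c′: if for every rational t > 0 and all KZ presentations S_j of the slices at level t
and T_j of the upper truncations R_j ∩ {s > t} one has Σ k_j([S_j] + [T_j]) − c′ ∈ KZ.relations,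
then c′ ∈ KZ.relations and Σ k_j[R_j ∩ {s > 0}] ∈ KZ.relations (card N2 'NSE', right half-line incl.
the +∞ end, integrated). [difficulty: open-problem] -/
@[route_item "route-KontsevichZagierPeriods-WeightLine", crux]
def BackwardVolterraRigidity : Prop :=
  ∀ (J : ℕ) (d : Fin J → ℕ) (k : Fin J → ℤ) (R : (j : Fin J) → Literature.NumberTheory.Transcendental.KZ.IntegralRep (d j + 1)) (c : Literature.NumberTheory.Transcendental.KZ.FormalRep), (∀ t : ℚ, 0 < (t : ℝ) → ∀ (S : (j : Fin J) → Literature.NumberTheory.Transcendental.KZ.IntegralRep (d j)) (T : (j : Fin J) → Literature.NumberTheory.Transcendental.KZ.IntegralRep (d j + 1)), (∀ j, (S j).domain = {x | Fin.snoc x (t : ℝ) ∈ (R j).domain} ∧ Set.EqOn (S j).integrand (fun x => (R j).integrand (Fin.snoc x (t : ℝ))) (S j).domain ∧ (T j).domain = (R j).domain ∩ {z | (t : ℝ) < z (Fin.last (d j))} ∧ Set.EqOn (T j).integrand (R j).integrand (T j).domain) → ∑ j, k j • (Literature.NumberTheory.Transcendental.KZ.of (S j) + Literature.NumberTheory.Transcendental.KZ.of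 (T j)) - c ∈ Literature.NumberTheory.Transcendental.KZ.relations) → c ∈ Literature.NumberTheory.Transcendental.KZ.relations ∧ ∀ (T₀ : (j : Fin J) → Literature.NumberTheory.Transcendental.KZ.IntegralRep (d j + 1)), (∀ j, (T₀ j).domain = (R j).domain ∩ {z | 0 < z (Fin.last (d j))} ∧ Set.EqOn (T₀ j).integrand (R j).integrand (T₀ j).domain) → ∑ j, k j • Literature.NumberTheory.Transcendental.KZ.of (T₀ j) ∈ Literature.NumberTheory.Transcendental.KZ.relations

/-- item stmt-KontsevichZagierPeriods-7178 · crux · rank 3 · open · by planner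
why it might fail: Pointwise relations slice_t ∼ trunc_t at rational t need not assemble into one relation for trunc_0 (no parameter move; ℤ-saturation 2c ∈ rel ⇒ c ∈ rel is untested); true at values by ODE uniqueness from the hard start and implied by KZKernelConjecture, so only unprovability threatens.
sources: KontsevichZagierPeriods2001, ComteLionRolin2000, LionRolin1998, Literature.NumberTheory.Transcendental.KZKernelConjecture, Literature.NumberTheory.Transcendental.KZ.relations_le_ker_eval
[crux] for classical total reps R_j supported in {s ≥ s₀}, integers k_j: if for every rational t < 0
and all KZ presentations S_j (slices at t), T_j (lower truncations R_j ∩ {s < t}) one has Σ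
k_j([S_j] − [T_j]) ∈ KZ.relations, then Σ k_j[R_j ∩ {s < 0}] ∈ KZ.relations (card N2 'NSE', left
half-line with hard start, integrated: no semialgebraic Volterra eigenfamily). [difficulty:
open-problem] -/
@[route_item "route-KontsevichZagierPeriods-WeightLine", crux]
def ForwardVolterraRigidity : Prop :=
  ∀ (J : ℕ) (d : Fin J → ℕ) (k : Fin J → ℤ) (R : (j : Fin J) → Literature.NumberTheory.Transcendental.KZ.IntegralRep (d j + 1)) (s₀ : ℝ), (∀ j, ∀ z ∈ (R j).domain, s₀ ≤ z (Fin.last (d j))) → (∀ t : ℚ, (t : ℝ) < 0 → ∀ (S : (j : Fin J) → Literature.NumberTheory.Transcendental.KZ.IntegralRep (d j)) (T : (j : Fin J) → Literature.NumberTheory.Transcendental.KZ.IntegralRep (d j + 1)), (∀ j, (S j).domain = {x | Fin.snoc x (t : ℝ) ∈ (R j).domain} ∧ Set.EqOn (S j).integrand (fun x => (R j).integrand (Fin.snoc x (t : ℝ))) (S j).domain ∧ (T j).domain = (R j).domain ∩ {z | z (Fin.last (d j)) < (t : ℝ)} ∧ Set.EqOn (T j).integrand (R j).integrand (T j).domain)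 → ∑ j, k j • (Literature.NumberTheory.Transcendental.KZ.of (S j) - Literature.NumberTheory.Transcendental.KZ.of (T j)) ∈ Literature.NumberTheory.Transcendental.KZ.relations) → ∀ (T₀ : (j : Fin J) → Literature.NumberTheory.Transcendental.KZ.IntegralRep (d j + 1)), (∀ j, (T₀ j).domain = (R j).domain ∩ {z | z (Fin.last (d j)) < 0} ∧ Set.EqOn (T₀ j).integrand (R j).integrand (T₀ j).domain) → ∑ j, k j • Literature.NumberTheory.Transcendental.KZ.of (T₀ j) ∈ Literature.NumberTheory.Transcendental.KZ.relations

/-- item stmt-KontsevichZagierPeriods-7179 · crux · rank 4 · open · by planner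
why it might fail: Ladder reps [branch, H(x,u_j(x,s))] can fail integrability though f = ∂ᵤH − H∂ᵤw ∈ L¹ (H = x⁻³(1+u²), w = u², |u| ≤ x): such parts factored through w and were KZ-null by a glued NL in every example, but a general renormalised normal form is unproved; (3b) tails, weight-jump walls.
sources: KontsevichZagierPeriods2001, arXiv:0811.2435, FresanJossen2020, BochnakCosteRoy1998, Literature.NumberTheory.Transcendental.KZexp.newtonLeibnizRel, Literature.NumberTheory.Transcendental.KZexp.improperNewtonLeibnizRel
[crux] if incl c ∈ KZexp.relations then there are finitely many classical total reps R_j (last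
coordinate = weight level, supports bounded below by some s₀) and k_j ∈ ℤ with θ(0<t)·c − Σ
k_j([slice_t R_j] − [R_j ∩ {s<t}]) ∈ KZ.relations for every rational t and all KZ presentations
(card N1 'L1' integrated: M_t kills moves 1a, 1b, 2; on a Newton–Leibniz instance LW-sorting makes
the primitive e^(−w)H, roots w = t give slices, H·∂_u w gives truncations, fibre ends cancel the
boundary rep). [deps: WeightBoundedBelow, ExpNotSemialgebraic] [difficulty: XL] -/
@[route_item "route-KontsevichZagierPeriods-WeightLine", crux]
def IntegratedLadderLaw : Prop :=
  ∀ c : Literature.NumberTheory.Transcendental.KZ.FormalRep, Literature.NumberTheory.Transcendental.KZexp.incl c ∈ Literature.NumberTheory.Transcendental.KZexp.relations → ∃ (J : ℕ) (d : Fin J → ℕ) (k : Fin J → ℤ) (R : (j : Fin J) → Literature.NumberTheory.Transcendental.KZ.IntegralRep (d j + 1)) (s₀ : ℝ), (∀ j, ∀ z ∈ (R j).domain, s₀ ≤ z (Fin.last (d j))) ∧ ∀ (t : ℚ) (S : (j : Fin J) → Literature.NumberTheory.Transcendental.KZ.IntegralRep (d j)) (T : (j : Fin J) → Literature.NumberTheory.Transcendental.KZ.IntegralRep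 (d j + 1)), (∀ j, (S j).domain = {x | Fin.snoc x (t : ℝ) ∈ (R j).domain} ∧ Set.EqOn (S j).integrand (fun x => (R j).integrand (Fin.snoc x (t : ℝ))) (S j).domain ∧ (T j).domain = (R j).domain ∩ {z | z (Fin.last (d j)) < (t : ℝ)} ∧ Set.EqOn (T j).integrand (R j).integrand (T j).domain) → (if (0 : ℚ) < t then c else 0) - ∑ j, k j • (Literature.NumberTheory.Transcendental.KZ.of (S j) - Literature.NumberTheory.Transcendental.KZ.of (T j)) ∈ Literature.NumberTheory.Transcendental.KZ.relations

/-- item stmt-KontsevichZagierPeriods-11034 · crux · rank 5 · open · by planner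
why it might fail: Rules-form exponential period conjecture for THIS 5-move calculus: stronger than the summit (GPC strength barrier) and may fail for calculus-size reasons (single-rep boundary terms, no product/Fubini move) even if every exponential identity is true.
sources: KontsevichZagierPeriods2001, FresanJossen2020, CommelinHabeggerHuber2020, arXiv:2007.08280, Literature.NumberTheory.Transcendental.KZexp.KernelConjecture, Literature.Barriers.KontsevichZagierPeriods.kzConjecture_implies_oddZetaAlgIndep
[crux] the exponential kernel conjecture for the landed five-move calculus KZexp: ker KZexp.eval ≤
KZexp.relations, i.e. every formal ℤ-combination of exponential representations with value 0 is an
exponential relation. Same content as Literature.NumberTheory.Transcendental.KZexp.KernelConjecture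
(ExpConservative's items 0531/0293, wanted by this route as ExpKernelConjecture until rev 2;
`SetLike.le_def` + `AddMonoidHom.mem_ker` convert either way), stated over the calculus' own
eval/relations so that the route's used-constants cone carries no Literature-level [status: open]
Prop (which made the route unstaffable). Standing hypothesis of the kernel half of the assembly.
[difficulty: open-problem] -/
@[route_item "route-KontsevichZagierPeriods-WeightLine", crux]
def ExpKernel : Prop :=
  AddMonoidHom.ker Literature.NumberTheory.Transcendental.KZexp.eval ≤ Literature.NumberTheory.Transcendental.KZexp.relations

/-- item stmt-KontsevichZagierPeriods-17729 · crux · rank 6 · open · by planner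
why it might fail: At a presentable level it asserts Σk_j[slice_t R_j] ∈ KZ.relations for a tame family with vanishing values: Conjecture-1-like unless the congruences G(a)−G(b)+B(a,b]∼0 can be exploited inside the moves; no parameter/scaling move exists off product families.
sources: KontsevichZagierPeriods2001, ComteLionRolin2000, CluckersMiller2011, FresanJossen2020, Literature.NumberTheory.Transcendental.KZ.domainAddRel, Literature.NumberTheory.Transcendental.KZ.relations_le_ker_eval
[crux] RIGIDITY CORE of BackwardVolterraRigidity (crux-strategist r1 BC2-redirect split of the
rank-2 crux, 2026-08-17; piece X1). For classical total reps R_j : KZ.IntegralRep (d_j+1) (level s =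
last coordinate), k_j ∈ ℤ, c : KZ.FormalRep: under the hypothesis H(c) of BackwardVolterraRigidity
VERBATIM (at every rational level t > 0, for all presentations S_j of the slices and T_j of the
upper truncations R_j ∩ {s > t}: Σ k_j([S_j]+[T_j]) − c ∈ KZ.relations) there is a FINITE set F ⊂ ℚ
of exceptional levels such that Σ k_j[T_j] − c ∈ KZ.relations for every rational t > 0 with t ∉ F
and all presentations T_j — the Volterra solution D(t) = Σ k_j[R_j ∩ {s>t}] is constant ≡ c modulo
relations off finitely many levels. NO LIMIT is taken in this piece: the finite exceptional set
absorbs the (finitely many) levels where a slice is not an integral representation, so X1 = 'slice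
vanishing' (card N2 NSE: G(t) = Σ k_j[slice_t R_j] ∈ relations wherever presentable — no
semialgebraic Volterra eigenfamily) + 'level tameness' (all but finitely many rational slices are
presentable: Fubini + Comte–Lion–Rolin / Cluckers–Miller Thm 1.3). Values shadow: v + V = C at good
levels, V′ = −v a.e., V(t) → 0 -/
@[route_item "route-KontsevichZagierPeriods-WeightLine"]
def UpperTruncationConstancy : Prop :=
  ∀ (J : ℕ) (d : Fin J → ℕ) (k : Fin J → ℤ) (R : (j : Fin J) → Literature.NumberTheory.Transcendental.KZ.IntegralRep (d j + 1)) (c : Literature.NumberTheory.Transcendental.KZ.FormalRep), (∀ t : ℚ, 0 < (t : ℝ) → ∀ (S : (j : Fin J) → Literature.NumberTheory.Transcendental.KZ.IntegralRep (d j)) (T : (j : Fin J) → Literature.NumberTheory.Transcendental.KZ.IntegralRep (d j + 1)), (∀ j, (S j).domain = {x | Fin.snoc x (t : ℝ) ∈ (R j).domain} ∧ Set.EqOn (S j).integrand (fun x => (R j).integrand (Fin.snoc x (t : ℝ))) (S j).domain ∧ (T j).domain = (R j).domain ∩ {z | (t : ℝ) < z (Fin.last (d j))} ∧ Set.EqOn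 (T j).integrand (R j).integrand (T j).domain) → ∑ j, k j • (Literature.NumberTheory.Transcendental.KZ.of (S j) + Literature.NumberTheory.Transcendental.KZ.of (T j)) - c ∈ Literature.NumberTheory.Transcendental.KZ.relations) → ∃ F : Finset ℚ, ∀ t : ℚ, 0 < (t : ℝ) → t ∉ F → ∀ (T : (j : Fin J) → Literature.NumberTheory.Transcendental.KZ.IntegralRep (d j + 1)), (∀ j, (T j).domain = (R j).domain ∩ {z | (t : ℝ) < z (Fin.last (d j))} ∧ Set.EqOn (T j).integrand (R j).integrand (T j).domain) → ∑ j, k j • Literature.NumberTheory.Transcendental.KZ.of (T j) - c ∈ Literature.NumberTheory.Transcendental.KZ.relations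

/-- item stmt-KontsevichZagierPeriods-17730 · crux · rank 7 · open · by planner
why it might fail: No move of the calculus passes to a countable exhaustion: off product families nothing converts the thin-band relations into one relation for the union. Implied by KZKernelConjecture at once, so only unprovability threatens; a refutation needs a move-invariant finer than eval.
sources: KontsevichZagierPeriods2001, Literature.NumberTheory.Transcendental.KZKernelConjecture, Literature.NumberTheory.Transcendental.KZ.relations_le_ker_eval, Literature.NumberTheory.Transcendental.KZ.IsDominatedFamily, Ayoub2015
[crux] LIMIT CORE of BackwardVolterraRigidity (crux-strategist r1 BC2-redirect split, 2026-08-17;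
piece X2: two-ended exhaustion tolerant of finitely many exceptional levels). For classical total
reps R_j : KZ.IntegralRep (d_j+1) (level s = last coordinate), k_j ∈ ℤ, a rational level t₀ and a
finite set F ⊂ ℚ: if every level band Σ k_j[R_j ∩ {a < s ≤ b}] with rational ends t₀ < a < b outside
F (all presentations) is a KZ relation, then the upper truncation Σ k_j[R_j ∩ {s > t₀}] (all
presentations) is a KZ relation. This isolates the ONLY two places where BVR passes to a limit — b →
+∞ to reach the jump c, a ↓ t₀ to reach the truncation at level t₀ (t₀ = 0 in BVR; t₀ = a good
positive level for c) — from all rigidity and tameness content (no hypothesis H, no slices). Implied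
by the kernel form of Conjecture 1 through dominated convergence (values: V(a) − V(b) = 0 for good a
< b, V(b) → 0, V right-continuous since level sets are null ⇒ V(t₀) = 0), hence only UNPROVABILITY
inside the four-move calculus threatens it: no move passes to a countable exhaustion. Provable now
in fibre dimension 0 (integrand zero off a finite set ⇒ relation by rule (1)) and for product
families r × weight (o -/
@[route_item "route-KontsevichZagierPeriods-WeightLine"]
def TruncationExhaustion : Prop :=
  ∀ (J : ℕ) (d : Fin J → ℕ) (k : Fin J → ℤ) (R : (j : Fin J) → Literature.NumberTheory.Transcendental.KZ.IntegralRep (d j + 1)) (t₀ : ℚ) (F : Finset ℚ), (∀ a b : ℚ, t₀ < a → a < b → a ∉ F → b ∉ F → ∀ (B : (j : Fin J) → Literature.NumberTheory.Transcendental.KZ.IntegralRep (d j + 1)), (∀ j, (B j).domain = (R j).domain ∩ {z | (a : ℝ) < z (Fin.last (d j)) ∧ z (Fin.last (d j)) ≤ (b : ℝ)} ∧ Set.EqOn (B j).integrand (R j).integrand (B j).domain) → ∑ j, k j • Literature.NumberTheory.Transcendental.KZ.of (B j) ∈ Literature.NumberTheory.Transcendental.KZ.relations) → ∀ (T : (j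 : Fin J) → Literature.NumberTheory.Transcendental.KZ.IntegralRep (d j + 1)), (∀ j, (T j).domain = (R j).domain ∩ {z | (t₀ : ℝ) < z (Fin.last (d j))} ∧ Set.EqOn (T j).integrand (R j).integrand (T j).domain) → ∑ j, k j • Literature.NumberTheory.Transcendental.KZ.of (T j) ∈ Literature.NumberTheory.Transcendental.KZ.relations

-- earlier WeightLineConservativity (stmt-KontsevichZagierPeriods-7180, replaced 2026-08-15T16:38:07Z -> stmt-KontsevichZagierPeriods-11047): retired by None — BackwardVolterraRigidity → ForwardVolterraRigidity → IntegratedLadderLaw → Literature.NumberTheory.Transcendental.KZexp.Conservative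
/-- item stmt-KontsevichZagierPeriods-11047 · support · rank 9 · open · by planner
sources: Literature.NumberTheory.Transcendental.KZexp.Conservative, Literature.NumberTheory.Transcendental.KZ.IntegralRep.restrict, Literature.NumberTheory.Transcendental.KZ.domainAddRel
[support] WeightLineConservativity, conservativity spelled INLINE (cone repair 2026-08-15): BVR →
FVR → ILL → (every weight-0 combination c : KZ.FormalRep with KZexp.incl c ∈ KZexp.relations lies in
KZ.relations) — definitionally `BVR → FVR → ILL → KZexp.Conservative` (the Literature-level
open-conjecture constant `KZexp.Conservative` is no longer named, so the route's used-constants cone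
carries no [status: open] Prop; provers may `show KZexp.Conservative` / `unfold` freely). The glue
of the conservativity half: t < 0 feeds FVR verbatim, giving trunc_(<0) ∼ 0; for rational t > 0
rewrite ILL with R_j ∩ {s<t} = (R_j ∩ {s<0}) ⊔ (R_j ∩ {0<s<t}) ⊔ null slice and feed BVR with c′ = c
+ Σ k_j[R_j ∩ {s>0}]; then c′ ∼ 0 ∧ Σ k_j[R_j ∩ {s>0}] ∼ 0 gives c ∼ 0; uses KZ.IntegralRep.restrict
and moves 1a only (checked on paper by the opener). Sources:
Literature.NumberTheory.Transcendental.KZexp.conservative_iff_comap_eq,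
Literature.NumberTheory.Transcendental.KZ.IntegralRep.restrict,
Literature.NumberTheory.Transcendental.KZ.domainAddRel, KontsevichZagierPeriods2001 §1.2/§4.3.
[difficulty: provable-now] -/
@[route_item "route-KontsevichZagierPeriods-WeightLine", crux]
def WeightLineConservativity : Prop :=
  BackwardVolterraRigidity → ForwardVolterraRigidity → IntegratedLadderLaw → ∀ c : Literature.NumberTheory.Transcendental.KZ.FormalRep, Literature.NumberTheory.Transcendental.KZexp.incl c ∈ Literature.NumberTheory.Transcendental.KZexp.relations → c ∈ Literature.NumberTheory.Transcendental.KZ.relations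

/-- item stmt-KontsevichZagierPeriods-17731 · support · rank 9 · closed · proved by Summit.KontsevichZagierPeriods.WeightLine.BackwardVolterraRigidityOfPieces.backwardVolterraRigidityOfPieces_proof @ 895fdc92d54b (prover) · by planner
sources: KontsevichZagierPeriods2001, Literature.NumberTheory.Transcendental.KZ.domainAddRel, Literature.NumberTheory.Transcendental.KZ.IntegralRep.restrict
[support] SPLIT GLUE of the rank-2 crux (crux-strategist r1, RESTATED re-audit: BC2 REDIRECT of
BackwardVolterraRigidity; the formal `route edit --split` is reserved by the gate for a seat's final
cycle, so — exactly as HermiteRigidity's ReductionRigidityOfCubes stmt-18142 — the decomposition is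
filed as items, and the staged command of Cruxes/BackwardVolterraRigidity/SPLIT-R1.md (`--split
BackwardVolterraRigidity --into children.json --glue-by …`) attaches to them by normalised
signature): UpperTruncationConstancy → TruncationExhaustion → BackwardVolterraRigidity. PROVED
sorry-free, rule (1) only, axioms propext/Classical.choice/Quot.sound, a ~45-line proof and not a
conjunction seam: (i) constancy at two good levels a < b plus domain additivity for ARBITRARY
presentations (band_mem_relations_of_constancy) ⇒ every level band with good positive rational ends
is a relation; (ii) a good level a₀ > 0 exists because the exceptional set is finite; exhaustion at
a₀ ⇒ D(a₀) ∈ rel, constancy ⇒ D(a₀) − c ∈ rel, hence c ∈ rel; (iii) exhaustion at t₀ = 0 with the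
same exceptional set ⇒ D(0) ∈ rel. Files: Cruxes/BackwardVolterraRigidity/SplitGlue.lean (theorem
Summit.KontsevichZagierPeriods.We -/
@[route_item "route-KontsevichZagierPeriods-WeightLine"]
def BackwardVolterraRigidityOfPieces : Prop :=
  UpperTruncationConstancy → TruncationExhaustion → BackwardVolterraRigidity

/-- item stmt-KontsevichZagierPeriods-7181 · support · rank 9 · open · by planner
sources: ComteLionRolin2000, CluckersMiller2011, BochnakCosteRoy1998, Literature.NumberTheory.Transcendental.KZexp.IntegralRep
[support] the weight of a convergent exponential representation is essentially bounded below on the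
support of the integrand: ∃ s₀, vol{x ∈ σ : f x ≠ 0, g x < s₀} = 0 (supplies the hard start s₀ of
ILL; o-minimal growth: vol{g < −T, f ≠ 0} and |f| decay at most polynomially while e^(−g) ≥ e^T).
[difficulty: L] -/
@[route_item "route-KontsevichZagierPeriods-WeightLine"]
def WeightBoundedBelow : Prop :=
  ∀ (n : ℕ) (r : Literature.NumberTheory.Transcendental.KZexp.IntegralRep n), ∃ s₀ : ℝ, MeasureTheory.volume {x | x ∈ r.domain ∧ r.integrand x ≠ 0 ∧ r.weight x < s₀} = 0

/-- item stmt-KontsevichZagierPeriods-7182 · support · rank 9 · closed · proved by Summit.KontsevichZagierPeriods.WeightLine.expNotSemialgebraic_proof @ 995d0d20fa1d (prover) · by planner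
sources: Literature.NumberTheory.Transcendental.LindemannWeierstrass.SumForm, Literature.Barriers.KontsevichZagierPeriods.noSemialgebraicPrimitive_inv_sub_two, BochnakCosteRoy1998
[support] exp is not ℚ-semialgebraic on any open interval (atom of the LW-sorting of primitives Σ
hᵢe^(−gᵢ) by exponential type and of 'no semialgebraic eigenfamily' in fibre dimension 0; from the
tree's Hermite–Lindemann transcendental_exp_holds at one rational point, or by growth). [difficulty:
provable-now] -/
@[route_item "route-KontsevichZagierPeriods-WeightLine"]
def ExpNotSemialgebraic : Prop :=
  ∀ a b : ℝ, a < b → ¬ Literature.NumberTheory.Transcendental.IsSemialgebraicFunOn ℚ {x : Fin 1 → ℝ | x 0 ∈ Set.Ioo a b} (fun x => Real.exp (x 0))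

/-- item stmt-KontsevichZagierPeriods-7183 · support · rank 9 · closed · proved by Summit.KontsevichZagierPeriods.WeightLine.betaGammaTruncated_proof @ 14b0d6b44621 (prover) · by planner
sources: Literature.NumberTheory.Transcendental.KZ.changeOfVariablesRel, KontsevichZagierPeriods2001, AndrewsAskeyRoy1999
[support] calibration (card N4b): the truncate-and-forget image of the Beta–Gamma change of
variables (ExpConservative 0533, (u,v) ↦ (uv, u(1−v)), weight x+y = u) is ONE KZ change of variables
at every rational level t: [{x,y>0, x+y<t}, x^(−2/3)y^(−2/3)] ~ [{0<u<t}×(0,1),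
u^(−1/3)(v(1−v))^(−2/3)] — weight-preserving moves produce no ladder. [difficulty: provable-now] -/
@[route_item "route-KontsevichZagierPeriods-WeightLine"]
def BetaGammaTruncated : Prop :=
  ∀ (t : ℚ) (r₁ r₂ : Literature.NumberTheory.Transcendental.KZ.IntegralRep 2), r₁.domain = {x | 0 < x 0 ∧ 0 < x 1 ∧ x 0 + x 1 < (t : ℝ)} → Set.EqOn r₁.integrand (fun x => (x 0) ^ (-(2:ℝ)/3) * (x 1) ^ (-(2:ℝ)/3)) r₁.domain → r₂.domain = {x | 0 < x 0 ∧ x 0 < (t : ℝ) ∧ x 1 ∈ Set.Ioo (0:ℝ) 1} → Set.EqOn r₂.integrand (fun x => (x 0) ^ (-(1:ℝ)/3) * (x 1 * (1 - x 1)) ^ (-(2:ℝ)/3)) r₂.domain → Literature.NumberTheory.Transcendental.KZ.Equivalent r₁ r₂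

-- earlier Assembly (stmt-KontsevichZagierPeriods-7184, replaced 2026-08-15T16:31:26Z -> stmt-KontsevichZagierPeriods-10974): retired by None — BackwardVolterraRigidity → ForwardVolterraRigidity → IntegratedLadderLaw → WeightLineConservativity → ExpKernelConjecture → KontsevichZagierPeriods
/-- item stmt-KontsevichZagierPeriods-11035 · assembly · rank 1 · closed · proved by Summit.KontsevichZagierPeriods.WeightLine.assembly_proof @ 52ab49a00509 (prover) · by planner
sources: Literature.NumberTheory.Transcendental.KZexp.eval_incl, Literature.NumberTheory.Transcendental.KZexp.Conservative, KontsevichZagierPeriods2001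
[assembly] BVR → FVR → ILL → WeightLineConservativity → ExpKernel → KontsevichZagierPeriods
(re-filed over the calculus-level crux ExpKernel after the rev-2 restate retired stmt-7184; the
deciding theorem `closes` proves exactly this implication). -/
@[route_item "route-KontsevichZagierPeriods-WeightLine"]
def Assembly : Prop :=
  BackwardVolterraRigidity → ForwardVolterraRigidity → IntegratedLadderLaw → WeightLineConservativity → ExpKernel → KontsevichZagierPeriods

/-! D-0027 §2.1 — DECIDING THEOREM (planner-authored via `route open/edit --closes-file`; by planner-rbadge-KontsevichZagierPeriods-WeightL-36e3e9a9-g2-0 2026-08-15T16:39:36Z):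
its hypotheses are this route's items and its conclusion the sub-problem Statement (glue_lint), and it elaborates with this file. -/

/-- D-0027 §2.1 deciding theorem of route WeightLine: the five listed items imply the summit.
`WeightLineConservativity` turns the three weight-line cruxes (backward/forward Volterra rigidity,
integrated ladder law) into `KZexp.Conservative`; `ExpKernel` is the exponential kernel conjecture
for the landed calculus, `ker KZexp.eval ≤ KZexp.relations` (the content of `KZexp.KernelConjecture`).
Given `r.value = r'.value`, the classical combination `[r] - [r']` satisfies
`KZexp.eval (incl ([r] - [r'])) = KZ.eval ([r] - [r']) = 0` (`KZexp.eval_incl`, `map_sub`, `KZ.eval_of`),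
so `ExpKernel` makes `incl ([r] - [r'])` an exponential relation and conservativity makes `[r] - [r']`
a KZ relation, which is `KZ.Equivalent r r'` by definition (rationality hypotheses unused).
[Kontsevich–Zagier 2001, §1.2, §4.3] [folklore] -/
@[closes "route-KontsevichZagierPeriods-WeightLine"] theorem closes (hB : BackwardVolterraRigidity) (hF : ForwardVolterraRigidity)
    (hI : IntegratedLadderLaw) (hW : WeightLineConservativity) (hE : ExpKernel) :
    KontsevichZagierPeriods := by
  intro n m r r' _ _ hv
  show Literature.NumberTheory.Transcendental.KZ.of r - Literature.NumberTheory.Transcendental.KZ.of r' ∈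
    Literature.NumberTheory.Transcendental.KZ.relations
  refine hW hB hF hI _ (hE ?_)
  rw [AddMonoidHom.mem_ker, Literature.NumberTheory.Transcendental.KZexp.eval_incl, map_sub,
    Literature.NumberTheory.Transcendental.KZ.eval_of, Literature.NumberTheory.Transcendental.KZ.eval_of,
    hv, sub_self]

end Summit.KontsevichZagierPeriods.KontsevichZagierPeriods.Theses.WeightLine
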